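import Summits.QuantumFields.YangMills.Theorems.BalabanLadderIRTwistedSlabGauge
import HarnessLib

/-!
# The sheet-adapted axial gauge of a twisted-flat `Fin`-box configuration trivialises every non-sheet link

HELPER toward stub **T1** `TwistedSlabAnchor` (LINE `twisted-slab-continuity`, crux `IRcof` stmt-QuantumFields-26930, census row 43;
LEAD prover ym-ir-line-tsc-p1 g2; `--supports` the crux, `--as helper`).  File 2/4 of next-seat-plan item (1) («Fin-box gauge
transformations + axial gauge ⇒ classification of twisted-flat configurations»); vocabulary in `…TwistedSlabGauge`.

For ANY group `G`, any box `(m₀+1) × (m₁+1) × (m₂+1) × (m₃+1)`, any 't Hooft tensor `w` (twist on the stacks `x_μ = x_ν = 0`) and any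
configuration `U` all of whose twisted plaquette holonomies are trivial:
* `plaquette_eq_one_of_coord_ne_zero` — off the stacks `U` is FLAT: at a site with `x_μ ≠ 0` both plaquettes of every plane containing `μ`
  are trivial (`finTorusPlaquette_eq_one_iff`, `finTorusPlaquette_eq_one_comm`: orientation bookkeeping);
* `transport_of_plaquettes_eq_one` — transport of a link across a row of trivial plaquettes (`row_transport` of `…SliceStokes`);
* `axialGaugeNat_succ_zero/one/two/three` — the axial gauge map `g = axialGauge U` (holonomy along the staircase from `(1,1,1,1)`, directions
  in the order `0,1,2,3`, never crossing a sheet) CLIMBS every non-sheet link: `g(x + e_μ) = g(x) · U(x, μ)` for `x_μ ≠ 0` — by `3 − μ`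
  transports through plaquettes that are off the stacks because `x_μ ≠ 0` (`axialGauge_shift`);
* ★ `gaugeAct_axialGauge_of_coord_ne_zero` — hence in the axial gauge EVERY NON-SHEET LINK IS TRIVIAL: `(g • U)(x, μ) = 1` for `x_μ ≠ 0`.
The sheet links and the classification are file 3 (`…TwistedSlabFlatClassification`).

HONEST FRAMING: lattice group algebra on one box (Creutz's axial gauge, adapted to the twist stacks); no estimate; nothing here bears on
`IRcof`, `IR`, or the Yang–Mills mass gap (Clay: NOT proved); R4 = `BalabanLadder.UV` only.  References: Creutz, Phys. Rev. D15 (1977)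
1128, §II; 't Hooft, Nucl. Phys. B153 (1979) §3; González-Arroyo, hep-th/9807108 §4.2.
-/

set_option autoImplicit false

open Literature.MathematicalPhysics.QuantumFieldTheory

namespace Summit.QuantumFields.YangMills.Cruxes.IRcof.TwistedSlab

variable {G : Type*} [Group G]

/-! ## §1 Plaquette orientation; transport across a row of trivial plaquettes -/

section Orientation

variable {n₀ n₁ n₂ n₃ : ℕ}

/-- A plaquette holonomy is trivial iff the two lattice paths around it agree. [folklore] -/
theorem finTorusPlaquette_eq_one_iff (U : FinTorusSite n₀ n₁ n₂ n₃ × Fin 4 → G) (x : FinTorusSite n₀ n₁ n₂ n₃)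
    (μ ν : Fin 4) :
    finTorusPlaquette U x μ ν = 1 ↔ U (x, μ) * U (x.shift μ, ν) = U (x, ν) * U (x.shift ν, μ) := by
  unfold finTorusPlaquette
  rw [mul_inv_eq_one, mul_inv_eq_iff_eq_mul]

/-- Triviality of a plaquette holonomy does not depend on the orientation in which it is read. [folklore] -/
theorem finTorusPlaquette_eq_one_comm (U : FinTorusSite n₀ n₁ n₂ n₃ × Fin 4 → G) (x : FinTorusSite n₀ n₁ n₂ n₃)
    (μ ν : Fin 4) : finTorusPlaquette U x μ ν = 1 ↔ finTorusPlaquette U x ν μ = 1 := by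
  rw [finTorusPlaquette_eq_one_iff, finTorusPlaquette_eq_one_iff, eq_comm]

/-- **Off the stacks a twisted-flat configuration is flat**: if `x_μ ≠ 0` then the plaquettes at `x` in every plane containing `μ`
are trivial, in both orientations ('t Hooft's tensor sits on the stack `x_μ = x_ν = 0`). [folklore] -/
theorem plaquette_eq_one_of_coord_ne_zero {w : Fin 4 → Fin 4 → G} {U : FinTorusSite n₀ n₁ n₂ n₃ × Fin 4 → G}
    (hflat : ∀ (x : FinTorusSite n₀ n₁ n₂ n₃) (μ ν : Fin 4), μ < ν →
      tHooftTwistTensor w x μ ν * finTorusPlaquette U x μ ν = 1)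
    {x : FinTorusSite n₀ n₁ n₂ n₃} {μ ν : Fin 4} (hμν : μ ≠ ν) (hx : finTorusSiteCoord x μ ≠ 0) :
    finTorusPlaquette U x μ ν = 1 ∧ finTorusPlaquette U x ν μ = 1 := by
  rcases lt_or_gt_of_ne hμν with h | h
  · have h1 := hflat x μ ν h
    rw [tHooftTwistTensor, if_neg (fun hc => hx hc.1), one_mul] at h1
    exact ⟨h1, (finTorusPlaquette_eq_one_comm U x μ ν).mp h1⟩
  · have h1 := hflat x ν μ h
    rw [tHooftTwistTensor, if_neg (fun hc => hx hc.2), one_mul] at h1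
    exact ⟨(finTorusPlaquette_eq_one_comm U x μ ν).mpr h1, h1⟩

end Orientation

/-- **Transport across a row of trivial plaquettes** (`row_transport` of `…SliceStokes` with trivial central factors): if
`u s · v (s+1) · (u' s)⁻¹ · (v s)⁻¹ = 1` for all `s`, then `v 0 · (u' 0 ⋯ u' (n−1)) = (u 0 ⋯ u (n−1)) · v n`. [folklore] -/
theorem transport_of_plaquettes_eq_one {u u' v : ℕ → G} (hP : ∀ s, u s * v (s + 1) * (u' s)⁻¹ * (v s)⁻¹ = 1) (n : ℕ) :
    v 0 * lprod u' n = lprod u n * v n := by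
  have h := row_transport (c := fun _ => (1 : G)) (fun _ => Subgroup.one_mem _) hP n
  rw [lprod_one, inv_one, one_mul] at h
  rw [h]; group

/-! ## §2 The axial gauge map climbs every non-sheet link: `g(x + e_μ) = g(x) · U(x, μ)` for `x_μ ≠ 0` -/

section Axial

open Fin.NatCast

variable {m₀ m₁ m₂ m₃ : ℕ} {w : Fin 4 → Fin 4 → G}
  {U : FinTorusSite (m₀ + 1) (m₁ + 1) (m₂ + 1) (m₃ + 1) × Fin 4 → G}

/-- A window coordinate `1 ≤ c ≤ m` of `natSite` is nonzero (the four directions). [folklore] -/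
theorem coord_natSite_ne_zero (i j k l : ℕ) :
    (1 ≤ i → i ≤ m₀ → finTorusSiteCoord (natSite m₀ m₁ m₂ m₃ i j k l) 0 ≠ 0) ∧
    (1 ≤ j → j ≤ m₁ → finTorusSiteCoord (natSite m₀ m₁ m₂ m₃ i j k l) 1 ≠ 0) ∧
    (1 ≤ k → k ≤ m₂ → finTorusSiteCoord (natSite m₀ m₁ m₂ m₃ i j k l) 2 ≠ 0) ∧
    (1 ≤ l → l ≤ m₃ → finTorusSiteCoord (natSite m₀ m₁ m₂ m₃ i j k l) 3 ≠ 0) := by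
  rw [finTorusSiteCoord_natSite]
  refine ⟨fun h1 h2 => ?_, fun h1 h2 => ?_, fun h1 h2 => ?_, fun h1 h2 => ?_⟩
  · show i % (m₀ + 1) ≠ 0
    rw [Nat.mod_eq_of_lt (by omega)]; omega
  · show j % (m₁ + 1) ≠ 0
    rw [Nat.mod_eq_of_lt (by omega)]; omega
  · show k % (m₂ + 1) ≠ 0
    rw [Nat.mod_eq_of_lt (by omega)]; omega
  · show l % (m₃ + 1) ≠ 0
    rw [Nat.mod_eq_of_lt (by omega)]; omega

/-- Step in direction `3` (pure bookkeeping: the path is extended by one link). [folklore] -/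
theorem axialGaugeNat_succ_three (U : FinTorusSite (m₀ + 1) (m₁ + 1) (m₂ + 1) (m₃ + 1) × Fin 4 → G) (i j k : ℕ) {l : ℕ}
    (hl : 1 ≤ l) : axialGaugeNat U i j k (l + 1) = axialGaugeNat U i j k l * U (natSite m₀ m₁ m₂ m₃ i j k l, 3) := by
  obtain ⟨l', rfl⟩ : ∃ l', l = l' + 1 := ⟨l - 1, by omega⟩
  simp only [axialGaugeNat, Nat.add_sub_cancel, lprod_succ, mul_assoc]

/-- Step in direction `2`: one transport of the `2`-link through the `(2,3)`-plaquettes at `x₂ = k ≠ 0`. [folklore] -/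
theorem axialGaugeNat_succ_two
    (hflat : ∀ (x : FinTorusSite (m₀ + 1) (m₁ + 1) (m₂ + 1) (m₃ + 1)) (μ ν : Fin 4), μ < ν →
      tHooftTwistTensor w x μ ν * finTorusPlaquette U x μ ν = 1)
    (i j : ℕ) {k l : ℕ} (hk1 : 1 ≤ k) (hk : k ≤ m₂) (hl : 1 ≤ l) :
    axialGaugeNat U i j (k + 1) l = axialGaugeNat U i j k l * U (natSite m₀ m₁ m₂ m₃ i j k l, 2) := by
  obtain ⟨l', rfl⟩ : ∃ l', l = l' + 1 := ⟨l - 1, by omega⟩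
  obtain ⟨k', rfl⟩ : ∃ k', k = k' + 1 := ⟨k - 1, by omega⟩
  have hT : U (natSite m₀ m₁ m₂ m₃ i j (k' + 1) (0 + 1), 2) *
        lprod (fun s => U (natSite m₀ m₁ m₂ m₃ i j (k' + 1 + 1) (s + 1), 3)) l' =
      lprod (fun s => U (natSite m₀ m₁ m₂ m₃ i j (k' + 1) (s + 1), 3)) l' * U (natSite m₀ m₁ m₂ m₃ i j (k' + 1) (l' + 1), 2) :=
    transport_of_plaquettes_eq_one (u := fun s => U (natSite m₀ m₁ m₂ m₃ i j (k' + 1) (s + 1), 3))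
      (u' := fun s => U (natSite m₀ m₁ m₂ m₃ i j (k' + 1 + 1) (s + 1), 3))
      (v := fun s => U (natSite m₀ m₁ m₂ m₃ i j (k' + 1) (s + 1), 2)) (fun s => by
        have h := (plaquette_eq_one_of_coord_ne_zero hflat (x := natSite m₀ m₁ m₂ m₃ i j (k' + 1) (s + 1))
          (μ := 2) (ν := 3) (by decide) ((coord_natSite_ne_zero _ _ _ _).2.2.1 hk1 hk)).2
        rwa [finTorusPlaquette, (natSite_shift _ _ _ _).2.2.2, (natSite_shift _ _ _ _).2.2.1] at h) l'
  rw [zero_add] at hT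
  simp only [axialGaugeNat, Nat.add_sub_cancel, lprod_succ, mul_assoc, hT]

/-- Step in direction `1`: transports through the `(1,2)`- and `(1,3)`-plaquettes at `x₁ = j ≠ 0`. [folklore] -/
theorem axialGaugeNat_succ_one
    (hflat : ∀ (x : FinTorusSite (m₀ + 1) (m₁ + 1) (m₂ + 1) (m₃ + 1)) (μ ν : Fin 4), μ < ν →
      tHooftTwistTensor w x μ ν * finTorusPlaquette U x μ ν = 1)
    (i : ℕ) {j k l : ℕ} (hj1 : 1 ≤ j) (hj : j ≤ m₁) (hk : 1 ≤ k) (hl : 1 ≤ l) :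
    axialGaugeNat U i (j + 1) k l = axialGaugeNat U i j k l * U (natSite m₀ m₁ m₂ m₃ i j k l, 1) := by
  obtain ⟨l', rfl⟩ : ∃ l', l = l' + 1 := ⟨l - 1, by omega⟩
  obtain ⟨k', rfl⟩ : ∃ k', k = k' + 1 := ⟨k - 1, by omega⟩
  obtain ⟨j', rfl⟩ : ∃ j', j = j' + 1 := ⟨j - 1, by omega⟩
  -- transport along direction 2 (plaquettes `(2,1)` at `natSite i (j'+1) (s+1) 1`)
  have hT2 : U (natSite m₀ m₁ m₂ m₃ i (j' + 1) (0 + 1) 1, 1) *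
        lprod (fun s => U (natSite m₀ m₁ m₂ m₃ i (j' + 1 + 1) (s + 1) 1, 2)) k' =
      lprod (fun s => U (natSite m₀ m₁ m₂ m₃ i (j' + 1) (s + 1) 1, 2)) k' * U (natSite m₀ m₁ m₂ m₃ i (j' + 1) (k' + 1) 1, 1) :=
    transport_of_plaquettes_eq_one (u := fun s => U (natSite m₀ m₁ m₂ m₃ i (j' + 1) (s + 1) 1, 2))
      (u' := fun s => U (natSite m₀ m₁ m₂ m₃ i (j' + 1 + 1) (s + 1) 1, 2))
      (v := fun s => U (natSite m₀ m₁ m₂ m₃ i (j' + 1) (s + 1) 1, 1)) (fun s => by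
        have h := (plaquette_eq_one_of_coord_ne_zero hflat (x := natSite m₀ m₁ m₂ m₃ i (j' + 1) (s + 1) 1)
          (μ := 1) (ν := 2) (by decide) ((coord_natSite_ne_zero _ _ _ _).2.1 hj1 hj)).2
        rwa [finTorusPlaquette, (natSite_shift _ _ _ _).2.2.1, (natSite_shift _ _ _ _).2.1] at h) k'
  -- transport along direction 3 (plaquettes `(3,1)` at `natSite i (j'+1) (k'+1) (s+1)`)
  have hT3 : U (natSite m₀ m₁ m₂ m₃ i (j' + 1) (k' + 1) (0 + 1), 1) *
        lprod (fun s => U (natSite m₀ m₁ m₂ m₃ i (j' + 1 + 1) (k' + 1) (s + 1), 3)) l' =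
      lprod (fun s => U (natSite m₀ m₁ m₂ m₃ i (j' + 1) (k' + 1) (s + 1), 3)) l' *
        U (natSite m₀ m₁ m₂ m₃ i (j' + 1) (k' + 1) (l' + 1), 1) :=
    transport_of_plaquettes_eq_one (u := fun s => U (natSite m₀ m₁ m₂ m₃ i (j' + 1) (k' + 1) (s + 1), 3))
      (u' := fun s => U (natSite m₀ m₁ m₂ m₃ i (j' + 1 + 1) (k' + 1) (s + 1), 3))
      (v := fun s => U (natSite m₀ m₁ m₂ m₃ i (j' + 1) (k' + 1) (s + 1), 1)) (fun s => by
        have h := (plaquette_eq_one_of_coord_ne_zero hflat (x := natSite m₀ m₁ m₂ m₃ i (j' + 1) (k' + 1) (s + 1))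
          (μ := 1) (ν := 3) (by decide) ((coord_natSite_ne_zero _ _ _ _).2.1 hj1 hj)).2
        rwa [finTorusPlaquette, (natSite_shift _ _ _ _).2.2.2, (natSite_shift _ _ _ _).2.1] at h) l'
  rw [zero_add] at hT2 hT3
  simp only [axialGaugeNat, Nat.add_sub_cancel, lprod_succ, mul_assoc, hT2, hT3]

/-- Step in direction `0`: transports through the `(0,1)`-, `(0,2)`- and `(0,3)`-plaquettes at `x₀ = i ≠ 0`. [folklore] -/
theorem axialGaugeNat_succ_zero
    (hflat : ∀ (x : FinTorusSite (m₀ + 1) (m₁ + 1) (m₂ + 1) (m₃ + 1)) (μ ν : Fin 4), μ < ν →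
      tHooftTwistTensor w x μ ν * finTorusPlaquette U x μ ν = 1)
    {i j k l : ℕ} (hi1 : 1 ≤ i) (hi : i ≤ m₀) (hj : 1 ≤ j) (hk : 1 ≤ k) (hl : 1 ≤ l) :
    axialGaugeNat U (i + 1) j k l = axialGaugeNat U i j k l * U (natSite m₀ m₁ m₂ m₃ i j k l, 0) := by
  obtain ⟨l', rfl⟩ : ∃ l', l = l' + 1 := ⟨l - 1, by omega⟩
  obtain ⟨k', rfl⟩ : ∃ k', k = k' + 1 := ⟨k - 1, by omega⟩
  obtain ⟨j', rfl⟩ : ∃ j', j = j' + 1 := ⟨j - 1, by omega⟩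
  obtain ⟨i', rfl⟩ : ∃ i', i = i' + 1 := ⟨i - 1, by omega⟩
  -- transport along direction 1 (plaquettes `(1,0)` at `natSite (i'+1) (s+1) 1 1`)
  have hT1 : U (natSite m₀ m₁ m₂ m₃ (i' + 1) (0 + 1) 1 1, 0) *
        lprod (fun s => U (natSite m₀ m₁ m₂ m₃ (i' + 1 + 1) (s + 1) 1 1, 1)) j' =
      lprod (fun s => U (natSite m₀ m₁ m₂ m₃ (i' + 1) (s + 1) 1 1, 1)) j' * U (natSite m₀ m₁ m₂ m₃ (i' + 1) (j' + 1) 1 1, 0) :=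
    transport_of_plaquettes_eq_one (u := fun s => U (natSite m₀ m₁ m₂ m₃ (i' + 1) (s + 1) 1 1, 1))
      (u' := fun s => U (natSite m₀ m₁ m₂ m₃ (i' + 1 + 1) (s + 1) 1 1, 1))
      (v := fun s => U (natSite m₀ m₁ m₂ m₃ (i' + 1) (s + 1) 1 1, 0)) (fun s => by
        have h := (plaquette_eq_one_of_coord_ne_zero hflat (x := natSite m₀ m₁ m₂ m₃ (i' + 1) (s + 1) 1 1)
          (μ := 0) (ν := 1) (by decide) ((coord_natSite_ne_zero _ _ _ _).1 hi1 hi)).2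
        rwa [finTorusPlaquette, (natSite_shift _ _ _ _).2.1, (natSite_shift _ _ _ _).1] at h) j'
  -- transport along direction 2 (plaquettes `(2,0)` at `natSite (i'+1) (j'+1) (s+1) 1`)
  have hT2 : U (natSite m₀ m₁ m₂ m₃ (i' + 1) (j' + 1) (0 + 1) 1, 0) *
        lprod (fun s => U (natSite m₀ m₁ m₂ m₃ (i' + 1 + 1) (j' + 1) (s + 1) 1, 2)) k' =
      lprod (fun s => U (natSite m₀ m₁ m₂ m₃ (i' + 1) (j' + 1) (s + 1) 1, 2)) k' *
        U (natSite m₀ m₁ m₂ m₃ (i' + 1) (j' + 1) (k' + 1) 1, 0) :=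
    transport_of_plaquettes_eq_one (u := fun s => U (natSite m₀ m₁ m₂ m₃ (i' + 1) (j' + 1) (s + 1) 1, 2))
      (u' := fun s => U (natSite m₀ m₁ m₂ m₃ (i' + 1 + 1) (j' + 1) (s + 1) 1, 2))
      (v := fun s => U (natSite m₀ m₁ m₂ m₃ (i' + 1) (j' + 1) (s + 1) 1, 0)) (fun s => by
        have h := (plaquette_eq_one_of_coord_ne_zero hflat (x := natSite m₀ m₁ m₂ m₃ (i' + 1) (j' + 1) (s + 1) 1)
          (μ := 0) (ν := 2) (by decide) ((coord_natSite_ne_zero _ _ _ _).1 hi1 hi)).2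
        rwa [finTorusPlaquette, (natSite_shift _ _ _ _).2.2.1, (natSite_shift _ _ _ _).1] at h) k'
  -- transport along direction 3 (plaquettes `(3,0)` at `natSite (i'+1) (j'+1) (k'+1) (s+1)`)
  have hT3 : U (natSite m₀ m₁ m₂ m₃ (i' + 1) (j' + 1) (k' + 1) (0 + 1), 0) *
        lprod (fun s => U (natSite m₀ m₁ m₂ m₃ (i' + 1 + 1) (j' + 1) (k' + 1) (s + 1), 3)) l' =
      lprod (fun s => U (natSite m₀ m₁ m₂ m₃ (i' + 1) (j' + 1) (k' + 1) (s + 1), 3)) l' *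
        U (natSite m₀ m₁ m₂ m₃ (i' + 1) (j' + 1) (k' + 1) (l' + 1), 0) :=
    transport_of_plaquettes_eq_one (u := fun s => U (natSite m₀ m₁ m₂ m₃ (i' + 1) (j' + 1) (k' + 1) (s + 1), 3))
      (u' := fun s => U (natSite m₀ m₁ m₂ m₃ (i' + 1 + 1) (j' + 1) (k' + 1) (s + 1), 3))
      (v := fun s => U (natSite m₀ m₁ m₂ m₃ (i' + 1) (j' + 1) (k' + 1) (s + 1), 0)) (fun s => by
        have h := (plaquette_eq_one_of_coord_ne_zero hflat (x := natSite m₀ m₁ m₂ m₃ (i' + 1) (j' + 1) (k' + 1) (s + 1))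
          (μ := 0) (ν := 3) (by decide) ((coord_natSite_ne_zero _ _ _ _).1 hi1 hi)).2
        rwa [finTorusPlaquette, (natSite_shift _ _ _ _).2.2.2, (natSite_shift _ _ _ _).1] at h) l'
  rw [zero_add] at hT1 hT2 hT3
  simp only [axialGaugeNat, Nat.add_sub_cancel, lprod_succ, mul_assoc, hT1, hT2, hT3]

/-- ★ **The axial gauge map climbs every non-sheet link**: `g(x + e_μ) = g(x) · U(x, μ)` whenever `x_μ ≠ 0`. [folklore] -/
theorem axialGauge_shift
    (hflat : ∀ (x : FinTorusSite (m₀ + 1) (m₁ + 1) (m₂ + 1) (m₃ + 1)) (μ ν : Fin 4), μ < ν →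
      tHooftTwistTensor w x μ ν * finTorusPlaquette U x μ ν = 1)
    (x : FinTorusSite (m₀ + 1) (m₁ + 1) (m₂ + 1) (m₃ + 1)) {μ : Fin 4} (hx : finTorusSiteCoord x μ ≠ 0) :
    axialGauge U (x.shift μ) = axialGauge U x * U (x, μ) := by
  obtain ⟨a, b, c, d⟩ := x
  have ha := one_le_finRep a
  have hb := one_le_finRep b
  have hc := one_le_finRep c
  have hd := one_le_finRep d
  fin_cases μ
  · have h0 : (a : ℕ) ≠ 0 := hx
    show axialGaugeNat U (finRep (finRotate (m₀ + 1) a)) (finRep b) (finRep c) (finRep d) =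
      axialGaugeNat U (finRep a) (finRep b) (finRep c) (finRep d) * U ((a, b, c, d), 0)
    rw [finRep_finRotate_of_ne_zero h0, axialGaugeNat_succ_zero hflat ha (finRep_of_ne_zero h0).2 hb hc hd, natSite_finRep]
  · have h0 : (b : ℕ) ≠ 0 := hx
    show axialGaugeNat U (finRep a) (finRep (finRotate (m₁ + 1) b)) (finRep c) (finRep d) =
      axialGaugeNat U (finRep a) (finRep b) (finRep c) (finRep d) * U ((a, b, c, d), 1)
    rw [finRep_finRotate_of_ne_zero h0, axialGaugeNat_succ_one hflat _ hb (finRep_of_ne_zero h0).2 hc hd, natSite_finRep]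
  · have h0 : (c : ℕ) ≠ 0 := hx
    show axialGaugeNat U (finRep a) (finRep b) (finRep (finRotate (m₂ + 1) c)) (finRep d) =
      axialGaugeNat U (finRep a) (finRep b) (finRep c) (finRep d) * U ((a, b, c, d), 2)
    rw [finRep_finRotate_of_ne_zero h0, axialGaugeNat_succ_two hflat _ _ hc (finRep_of_ne_zero h0).2 hd, natSite_finRep]
  · have h0 : (d : ℕ) ≠ 0 := hx
    show axialGaugeNat U (finRep a) (finRep b) (finRep c) (finRep (finRotate (m₃ + 1) d)) =
      axialGaugeNat U (finRep a) (finRep b) (finRep c) (finRep d) * U ((a, b, c, d), 3)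
    rw [finRep_finRotate_of_ne_zero h0, axialGaugeNat_succ_three U _ _ _ hd, natSite_finRep]

/-- ★ **In the axial gauge every non-sheet link is trivial**: `(g • U)(x, μ) = 1` for `x_μ ≠ 0`, `g = axialGauge U`. [folklore] -/
theorem gaugeAct_axialGauge_of_coord_ne_zero
    (hflat : ∀ (x : FinTorusSite (m₀ + 1) (m₁ + 1) (m₂ + 1) (m₃ + 1)) (μ ν : Fin 4), μ < ν →
      tHooftTwistTensor w x μ ν * finTorusPlaquette U x μ ν = 1)
    (x : FinTorusSite (m₀ + 1) (m₁ + 1) (m₂ + 1) (m₃ + 1)) {μ : Fin 4} (hx : finTorusSiteCoord x μ ≠ 0) :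
    gaugeAct (axialGauge U) U (x, μ) = 1 := by
  rw [gaugeAct_apply, axialGauge_shift hflat x hx, mul_inv_rev, ← mul_assoc, mul_inv_cancel_right, mul_inv_cancel]

end Axial

end Summit.QuantumFields.YangMills.Cruxes.IRcof.TwistedSlab
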